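import Summits.BirchSwinnertonDyer.BirchSwinnertonDyer.Theorems.SignedLowerHalvesSmallImageLowerHalfBothSignsRttCharRoadE1InjTopOfInputs
import Summits.BirchSwinnertonDyer.BirchSwinnertonDyer.Theorems.SignedLowerHalvesSmallImageLowerHalfBothSignsRttCharRoadE1InjTopI8
import Summits.BirchSwinnertonDyer.BirchSwinnertonDyer.Theorems.SignedLowerHalvesSmallImageLowerHalfBothSignsRttCharRoadTInputs
import Summits.BirchSwinnertonDyer.BirchSwinnertonDyer.Theorems.SignedLowerHalvesSmallImageLowerHalfBothSignsRttCharRoadTorsionFixedPoints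
import Summits.BirchSwinnertonDyer.BirchSwinnertonDyer.Theorems.SignedLowerHalvesSmallImageLowerHalfBothSignsRttCharRoadE1KStructureBridge
import Summits.BirchSwinnertonDyer.BirchSwinnertonDyer.Theorems.SignedLowerHalvesSmallImageLowerHalfBothSignsRttCharRoadE1JointInjectivity
import Summits.BirchSwinnertonDyer.BirchSwinnertonDyer.Theorems.SignedLowerHalvesSmallImageLowerHalfBothSignsRttCharRoadE1ThetaSideFacts
import Summits.BirchSwinnertonDyer.BirchSwinnertonDyer.Theorems.SignedLowerHalvesSmallImageLowerHalfBothSignsRttCharRoadE1CartanRange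
import Summits.BirchSwinnertonDyer.BirchSwinnertonDyer.Theorems.SignedLowerHalvesSmallImageLowerHalfBothSignsRttCharRoadE1GlobalEquivariance
import Summits.BirchSwinnertonDyer.BirchSwinnertonDyer.Theorems.SignedLowerHalvesSmallImageLowerHalfBothSignsRttCharRoadE1OfInjTop
import HarnessLib

/-!
# Route `SignedLowerHalves`, crux L `SmallImageLowerHalfBothSigns` (stmt-BirchSwinnertonDyer-23599), line `rtt_w3` v12 — glue `charRoad_injTop`,
# LEAD: THE WRAPPER (W2)–(W3) of memo `Lines/rtt_w3-GLUE-g7.md` §6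

WHY: the registered stub `stub_charRoad_ns` (v12) is `∀ shared binders, INJ_top ∧ (∀ Dψ, E2)`. This file proves the INJ_top conjunct VERBATIM
(= hypothesis `hinj` of `SmallImageRttCharRoad.charRoad_countPi_of_injTop`, p766754) from the landed composition `injTop_of_inputs` (LEAD g7,
p770240) by instantiating its inputs: (I8) the inert local square with a KERNEL-level transversal and the cores data (`…E1InjTopI8`, LEAD g8);
(I1)(I2)(I3)(I7)+`hsinj`+`hw`+`hfaith` honda's `exists_injTop_T_inputs` (p770690); (I4) g18's `exists_kStructure_bridge` (p769384) with
`ρ̄⁻¹kˣ = galRange K` (p768028); (I5) `continuous_smul_cofree`/`exists_smul_eq_cofree`/`nsmul_eq_zero_of_smul_eq_zero_of_irreducible`/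
`inertiaIn_layerSubgroup_smul_cofree_eq` (p769877) and g18's global equivariance `coord_smul_of_inputs`; (I6) g18's
`oneCocycleClass_eq_zero_of_forall_comp_eq_zero` (p769853) fed by honda's `hT0`. After this lands the LEAD reshapes v13 (INJ_top struck from
`stub_charRoad_ns`, which becomes `∀ Dψ, E2` only). THEOREM ONLY; BSD / crux L / E2 are NOT proved here.
[cite: Kobayashi2003, Def. 1.1] [cite: BDKim2009, pp. 182, 185] [cite: SerreGaloisCohomology1997, I §2.4, I §5.8, II §1.1] [cite: Serre1972, §2.2]
-/

set_option autoImplicit false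
-- D-0017: single-problem summit, the namespace repeats the problem name by design.
set_option linter.dupNamespace false
noncomputable section

open scoped Classical MatrixGroups ModularForm BigOperators NumberField

open CongruenceSubgroup WeierstrassCurve Field Polynomial NumberField IsDedekindDomain Matrix
  Literature.NumberTheory.EllipticCurves Literature.NumberTheory.EllipticCurves.ModularForms
  Literature.NumberTheory.EllipticCurves.Rank1Residual
  Literature.NumberTheory.EllipticCurves.Kobayashi2003
  Literature.NumberTheory.EllipticCurves.GreenbergVatsal2000 ZpExtension
  Literature.NumberTheory.IwasawaTheory Rat.HeightOneSpectrum
  Literature.NumberTheory.GaloisRepresentations Literature.NumberTheory.LFunctions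
  Literature.NumberTheory.GaloisRepresentations.HeckeCharacter Literature.NumberTheory.Automorphic
  Literature.NumberTheory.GaloisRepresentations.LubinTate
  Summit.BirchSwinnertonDyer.Rank1Residual Summit.BirchSwinnertonDyer.Rank1Residual.Supersingular
  Summit.BirchSwinnertonDyer.Rank1Residual.X1.MuLambda
  Summit.BirchSwinnertonDyer.Rank1Residual.X2.EulerFactorInvariants
  Summit.BirchSwinnertonDyer.BirchSwinnertonDyer.Theorems.SmallImageLambdaLowerThreeNsThetaTransport
  Summit.BirchSwinnertonDyer.BirchSwinnertonDyer.Theorems.HeckeThetaPartner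
  Summit.BirchSwinnertonDyer.BirchSwinnertonDyer.Theorems
  Summit.BirchSwinnertonDyer.BirchSwinnertonDyer.Theorems.SmallImageCharSignedSelmer

namespace Summit.BirchSwinnertonDyer.BirchSwinnertonDyer.Theorems.SmallImageRttCharRoad

/-- ★★★ **INJ_top (`charRoad_injTop`).** For the crux pair `(W, p)` and every datum of the shared prefix of `stub_charRoad_ns` (v12): for every irreducible
`π ∈ 𝒪_S` there are `N` with `p^N ≤ #(𝒪_S/π)` and an injection of `Sel^{ε,S₀K,sat}_{𝒪_S}(K_∞, (F_S/𝒪_S)(θ))[π]` into `N` copies of B. D. Kim's signed Selmer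
group `S^{S₀,ε}(ℚ_∞, W[p^∞])[p]` (`AcSigned.selmer`). `= injTop_of_inputs` ∘ ((I8) `…E1InjTopI8`, T-inputs `exists_injTop_T_inputs`, bridge
`exists_kStructure_bridge`, joint injectivity `oneCocycleClass_eq_zero_of_forall_comp_eq_zero`, `θ`-side facts). The type is the hypothesis `hinj` of
`charRoad_countPi_of_injTop` verbatim. [cite: Kobayashi2003, Def. 1.1] [cite: BDKim2009, pp. 182, 185] [cite: SerreGaloisCohomology1997, I §2.4, I §5.8, II §1.1]
[cite: Serre1972, §2.2] -/
theorem charRoad_injTop :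
    ∀ (W : WeierstrassCurve ℚ) [W.IsElliptic] [W.IsGloballyMinimal] (p : ℕ) [Fact p.Prime],
            ∀ (hp : p ≠ 2), ClassX7 W p → ¬ W.HasCM → W.frobeniusTrace p = 0 → ¬ Surj W p →
            ¬ (∃ (A : WeierstrassCurve ℚ) (_ : A.IsElliptic) (_ : A.IsGloballyMinimal),
              A.HasCM ∧ GoodSS A p ∧ A.frobeniusTrace p = 0 ∧
                ∃ e : geomTorsion W (p : ℤ) ≃+ geomTorsion A (p : ℤ),
                  ∀ (σ : absoluteGaloisGroup ℚ) (P : geomTorsion W (p : ℤ)), e (σ • P) = σ • e P) →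
            ¬ (∃ (A : WeierstrassCurve ℚ) (_ : A.IsElliptic) (_ : A.IsGloballyMinimal) (t : ℚ),
              A.HasGoodReductionAtPrime p ∧ A.frobeniusTrace p = 0 ∧
                (∃ e : geomTorsion W (p : ℤ) ≃+ geomTorsion A (p : ℤ),
                  ∀ (σ : absoluteGaloisGroup ℚ) (P : geomTorsion W (p : ℤ)), e (σ • P) = σ • e P) ∧
                A.entireLFunction 1 / (A.realPeriodRat : ℂ) = ((t : ℚ) : ℂ) ∧ t ≠ 0 ∧ padicValRat p t = 0) →
            ∀ (ε : ℤˣ) (K : Type) [Field K] [NumberField K] (σK : K →+* ℂ) (𝔪 : Ideal (𝓞 K))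
              (ψ : HeightOneSpectrum (𝓞 K) → ℂ) (e : PadicAlgCl p ≃+* ℂ),
              ∀ (hK2 : Module.finrank ℚ K = 2), IsTotallyComplex K → 𝔪 ≠ ⊥ →
              (∀ I : Ideal (𝓞 K), Ideal.absNorm I ≠ p) → ¬ p ∣ (NumberField.discr K).natAbs * Ideal.absNorm 𝔪 →
              (∀ (ℓ : ℕ) [Fact ℓ.Prime], ℓ ∣ (NumberField.discr K).natAbs * Ideal.absNorm 𝔪 → ¬ W.HasGoodReductionAtPrime ℓ) →
              IsGrossencharakter 𝔪 (embType σK) (embTypeConj σK) ψ →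
              (∀ n : ℕ, Odd n → n.Coprime ((NumberField.discr K).natAbs * Ideal.absNorm 𝔪) →
                idealPow K ψ (Ideal.span {(n : 𝓞 K)}) = (jacobiSym (NumberField.discr K) n : ℂ) * (n : ℂ) ^ (2 - 1)) →
              (∀ (ℓ : ℕ) [Fact ℓ.Prime], ℓ ≠ p → W.HasGoodReductionAtPrime ℓ →
                ‖e.symm (∑ᶠ (w : HeightOneSpectrum (𝓞 K)) (_ : Ideal.absNorm w.asIdeal = ℓ), ψ w) -
                  (W.frobeniusTrace ℓ : PadicAlgCl p)‖ < 1) →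
              (∃ v : HeightOneSpectrum (𝓞 K), v.asIdeal = Ideal.span {(p : 𝓞 K)} ∧ Nat.card (𝓞 K ⧸ v.asIdeal) = p ^ 2) →
              ¬ (p : ℤ) ∣ NumberField.discr K →
            ∀ (Φ : Multiplicative (AddAut (geomTorsion W p)) ≃* GL (Fin 2) (ZMod p))
              (k : Subalgebra (ZMod p) (Matrix (Fin 2) (Fin 2) (ZMod p))) (e₀ : geomTorsion W p ≃+ (Fin 2 → ZMod p)),
              (∀ (g : Multiplicative (AddAut (geomTorsion W p))) (x : geomTorsion W p),
                e₀ (Multiplicative.toAdd g x) = ((Φ g : GL (Fin 2) (ZMod p)) : Matrix (Fin 2) (Fin 2) (ZMod p)) *ᵥ e₀ x) →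
              IsField k → Module.finrank (ZMod p) k = 2 →
              (letI : Module (ZMod p) (geomTorsion W p) := AddSubgroup.torsionBy.zmodModule
                ∀ g : Multiplicative (AddAut (geomTorsion W p)),
                  Matrix.trace ((Φ g : GL (Fin 2) (ZMod p)) : Matrix (Fin 2) (Fin 2) (ZMod p)) =
                    LinearMap.trace (ZMod p) (geomTorsion W p) ((Multiplicative.toAdd g).toAddMonoidHom.toZModLinearMap p)) →
              (galoisRepTorsion W p).range.map Φ.toMonoidHom ≤
                Subgroup.normalizer (Serre1972.unitGroup k : Set (GL (Fin 2) (ZMod p))) →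
              ((Serre1972.unitGroup k).comap Φ.toMonoidHom).comap (galoisRepTorsion W p) ≤
                (absGaloisRestrict ℚ K).toMonoidHom.range →
              (∀ τ : absoluteGaloisGroup K, Φ (galoisRepTorsion W p (absGaloisRestrict ℚ K τ)) ∈ Serre1972.unitGroup k) →
            ∀ (M : ℕ) [NeZero M] (g : CuspForm (Gamma0 M) 2) (ι : coeffField g →+* PadicAlgCl p) (Ω : ℂ),
              ¬ p ∣ M → IsNewform0 g → Literature.NumberTheory.Automorphic.IsCMForm (liftToGamma1 M 2 g) →
              cuspCoeff g p = 0 → IsCohomologicalPlusPeriod g ι Ω →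
              (∀ ℓ : ℕ, ℓ.Prime → ¬ ℓ ∣ p * M * W.conductorNorm ℤ →
                ‖embCoeff g ι ℓ - (W.frobeniusTrace ℓ : PadicAlgCl p)‖ < 1) →
              (∀ ℓ : ℕ, ℓ.Prime → ¬ ℓ ∣ (NumberField.discr K).natAbs * Ideal.absNorm 𝔪 →
                embCoeff g ι ℓ = e.symm (∑ᶠ (w : HeightOneSpectrum (𝓞 K)) (_ : Ideal.absNorm w.asIdeal = ℓ), ψ w)) →
              ∀ (κ : ZpExtension ℚ p) (γ : absoluteGaloisGroup ℚ),
                κ.IsCyclotomic → κ.IsTopGenerator γ → IsCyclotomicVariable p γ →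
              ∀ (S₀ : Finset (HeightOneSpectrum (𝓞 ℚ))), (∀ v ∈ S₀, ((p : ℕ) : 𝓞 ℚ) ∉ v.asIdeal) →
                (∀ v : HeightOneSpectrum (𝓞 ℚ), ¬ W.HasGoodReductionAt v → v ∈ S₀) →
                (∀ v : HeightOneSpectrum (𝓞 ℚ), natGenerator v ∣ M → v ∈ S₀) →
              ∀ (S : Set (PadicAlgCl p)) (θ : FramedGaloisRep K (padicCoeffIntegers S) 1) (γK : absoluteGaloisGroup K)
                (j : (W.baseChange K).geomPrimaryTorsion p →+ (GreenbergSelmer.Cofree θ (padicCoeffField S))),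
                0 < Module.finrank ℚ_[p] (padicCoeffField S) →
                (∀ w : HeightOneSpectrum (𝓞 K), (p : 𝓞 K) ∉ w.asIdeal → ¬ 𝔪 ≤ w.asIdeal →
                  θ.IsUnramifiedAt w ∧ ∃ P : Polynomial (padicCoeffIntegers S),
                    P.map (padicCoeffIntegers S).subtype = X - C (e.symm (ψ w)) ∧ θ.HasFrobCharpolyAt w P) →
                (κ.restrictOfFinrankEqTwo hp K hK2).IsTopGenerator γK →
                (∀ v : HeightOneSpectrum (𝓞 K), (p : 𝓞 K) ∈ v.asIdeal →
                  ∀ (δ : absoluteGaloisGroup (v.adicCompletion K)) (t : (W.baseChange K).geomPrimaryTorsion p),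
                    j (resGalOfEmb (closureEmb (K := K) (v.adicCompletion K)) δ • t) =
                      resGalOfEmb (closureEmb (K := K) (v.adicCompletion K)) δ • j t) →
                Submodule.span (padicCoeffIntegers S) (Set.range j) = ⊤ →
              ∀ (π : padicCoeffIntegers S), Irreducible π →
                ∃ N : ℕ, p ^ N ≤ Nat.card (padicCoeffIntegers S ⧸ Ideal.span {π}) ∧
                  ∃ incl : {s : SmallImageCharSignedSelmer.signedTransportSelmerInftySat (κ.restrictOfFinrankEqTwo hp K hK2)
                    (GreenbergSelmer.Cofree θ (padicCoeffField S)) (padicCoeffIntegers S) (W.baseChange K) j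
                    {w : HeightOneSpectrum (𝓞 K) | ∃ v ∈ S₀, ((natGenerator v : ℕ) : 𝓞 K) ∈ w.asIdeal} ε | GreenbergSelmer.scalarH1 (κ.restrictOfFinrankEqTwo hp K hK2).kerSubgroup (GreenbergSelmer.Cofree θ (padicCoeffField S)) π s = 0} →
                      (Fin N → {x : AcSigned.selmer W p κ (S₀ : Set (HeightOneSpectrum (𝓞 ℚ))) (fun _ ↦ AcSigned.PCond.sgn ε) | p • x = 0}),
                    Function.Injective incl := by
  intro W _ _ p _ hp hX hcm hap hsj hT1 hTu ε K _ _ σK 𝔪 ψ e hK2 htc h𝔪 hnop hpD hbad hψG hneb htrace hv hpd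
    Φ k e₀ he₀ hk h2 htr hGN hUle hKU M _ g ιg Ω hpM hnew hcmf hapg hΩ hcong hcoeff κ γ hκ hγ hγT S₀ hS₀p hS₀bad hS₀M
    S θ γK j hfin hθ hγK hjeq hjspan π hπ
  haveI : FiniteDimensional ℚ_[p] (padicCoeffField S) := Module.finite_of_finrank_pos hfin
  -- the inert place `w = (p)` of `K` over `v₀` of `ℚ`
  obtain ⟨w, hw, -⟩ := hv
  have hpw : (p : 𝓞 K) ∈ w.asIdeal := by rw [hw]; exact Ideal.subset_span rfl
  set v₀ : HeightOneSpectrum (𝓞 ℚ) := w.under (𝓞 ℚ) with hv₀def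
  haveI hwv : w.asIdeal.LiesOver v₀.asIdeal := ⟨by rw [hv₀def, HeightOneSpectrum.under_asIdeal]⟩
  have hv₀ : ((p : ℕ) : 𝓞 ℚ) ∈ v₀.asIdeal := by
    rw [hv₀def, HeightOneSpectrum.under_asIdeal, Ideal.under_def, Ideal.mem_comap, map_natCast]
    exact hpw
  -- (I8): local square with a kernel-level transversal, cores data, openness, continuity (LEAD g8 `…E1InjTopI8`)
  obtain ⟨ι, ι₂, hcompat, hι₂, hfixU, c, hc, hcU⟩ := exists_localSquare_ker_of_eq_span K v₀ w hw hK2 hp κ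
  choose eN eN' heN heN' using fun n : ℕ ↦ exists_continuousMonoidHom_subgroupOf_inf_pair (κ.layerSubgroup n) (galRange (K := ℚ) K)
  obtain ⟨einf, einf', heinf, heinf'⟩ := exists_continuousMonoidHom_subgroupOf_inf_pair κ.kerSubgroup (galRange (K := ℚ) K)
  choose incN hincN using fun n : ℕ ↦
    exists_continuousMonoidHom_subgroupOf_inclusion (galRange (K := ℚ) K) (κ.kerSubgroup_le_layerSubgroup n)
  haveI hUn : (galRange (K := ℚ) K).Normal := Subgroup.normal_of_index_eq_two (index_galRange_eq_two K hK2)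
  haveI : ∀ n : ℕ, ((galRange (K := ℚ) K).subgroupOf (κ.layerSubgroup n)).Normal := fun n ↦ inferInstance
  haveI : ((galRange (K := ℚ) K).subgroupOf κ.kerSubgroup).Normal := inferInstance
  have hN : ∀ n : ℕ, IsOpen (((galRange (K := ℚ) K).subgroupOf (κ.layerSubgroup n) : Subgroup (κ.layerSubgroup n)) :
      Set (κ.layerSubgroup n)) := fun n ↦ (isOpen_galRange K).preimage continuous_subtype_val
  have hNinf : IsOpen (((galRange (K := ℚ) K).subgroupOf κ.kerSubgroup : Subgroup κ.kerSubgroup) : Set κ.kerSubgroup) :=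
    (isOpen_galRange K).preimage continuous_subtype_val
  have hopen : ∀ n : ℕ, IsOpen ((κ.layerSubgroup n ⊓ galRange (K := ℚ) K : Subgroup (absoluteGaloisGroup ℚ)) :
      Set (absoluteGaloisGroup ℚ)) := fun n ↦ by
    rw [Subgroup.coe_inf]
    exact (κ.isOpen_layerSubgroup n).inter (isOpen_galRange K)
  have hirr : W.HasIrreducibleModPGaloisRep p := ClassX7.irr W p hp hX
  -- `ρ̄⁻¹kˣ = galRange K` (p768028)
  have hmemU : ∀ τ : absoluteGaloisGroup ℚ, τ ∈ galRange (K := ℚ) K ↔ Φ (galoisRepTorsion W p τ) ∈ Serre1972.unitGroup k := fun τ ↦ by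
    rw [← comap_unitGroup_eq_galRange W K Φ k hUle hKU, Subgroup.mem_comap, Subgroup.mem_comap]
    rfl
  -- the T-side inputs (honda p770690)
  obtain ⟨uK, ιv, d, s, -, hJ, hsinj, hs_loc, hs_gen, hû_loc, hû_stab, -, hadd, hmul, hone, -, hgal, -, -, hιv, hslin, -, hw', hfaith⟩ :=
    exists_injTop_T_inputs W p hp hX hap K w hK2 hw θ j hfin (hjeq w hpw) hjspan π hπ
  -- the bridge (I4) (g18 p769384)
  obtain ⟨y, u, v, b, -, -, -, -, -, hvu, hσu, hσv, hcu', hbridge⟩ := exists_kStructure_bridge K W Φ k e₀ he₀ hp hk h2 hGN hKU uK hadd hmul hone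
    (closureEmb (K := K) (w.adicCompletion K)) _ hgal hw'
  have hu : ∀ τ : absoluteGaloisGroup ℚ, τ ∈ galRange (K := ℚ) K → ∀ m : geomTorsion W p, u (τ • m) = τ • u m :=
    fun τ hτ ↦ hσu τ ((hmemU τ).1 hτ)
  have hv' : ∀ τ : absoluteGaloisGroup ℚ, τ ∈ galRange (K := ℚ) K → ∀ m : geomTorsion W p, v (τ • m) = τ • v m :=
    fun τ hτ ↦ hσv τ ((hmemU τ).1 hτ)
  have hcu : ∀ m : geomTorsion W p, u (resGalOfEmb ι c • m) = -(resGalOfEmb ι c • u m) :=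
    hcu' _ (fun h ↦ hcU ((hmemU _).2 h))
  -- the `θ`-side (I5) (g18 p769877 + global equivariance)
  set Sπ : AddSubgroup (GreenbergSelmer.Cofree θ (padicCoeffField S)) :=
    (DistribSMul.toAddMonoidHom (GreenbergSelmer.Cofree θ (padicCoeffField S)) π).ker with hSπdef
  have hSπ : ∀ m : GreenbergSelmer.Cofree θ (padicCoeffField S), m ∈ Sπ ↔ π • m = 0 := fun m ↦ by
    rw [hSπdef, AddMonoidHom.mem_ker, DistribSMul.toAddMonoidHom_apply]
  have hπp : ∀ m : GreenbergSelmer.Cofree θ (padicCoeffField S), π • m = 0 → p • m = 0 := fun m hm ↦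
    nsmul_eq_zero_of_smul_eq_zero_of_irreducible hπ hm
  have hpS : ∀ m : GreenbergSelmer.Cofree θ (padicCoeffField S), m ∈ Sπ → p • m = 0 := fun m hm ↦ hπp m ((hSπ m).1 hm)
  have hcglob : Φ (galoisRepTorsion W p (resGalOfEmb ι c)) ∉ Serre1972.unitGroup k := fun h ↦ hcU ((hmemU _).2 h)
  have hs_S : ∀ (l : Fin d) (g : absoluteGaloisGroup K) (m : GreenbergSelmer.Cofree θ (padicCoeffField S)), m ∈ Sπ →
      s l (g • m) = g • s l m := fun l g m hm ↦
    coord_smul_of_inputs W Φ K hp hk h2 e₀ he₀ htr hGN hK2 hKU 𝔪 h𝔪 ψ e hneb htrace θ hθ (resGalOfEmb ι c) hcglob uK hadd hmul hone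
      (closureEmb (K := K) (w.adicCompletion K)) _ hgal ιv hιv hw' hfaith hπ Sπ hSπ (s l) (hslin l) g m hm
  have hT0 : ∀ t : (W.baseChange K).geomPrimaryTorsion p,
      (∀ x : (κ.restrictOfFinrankEqTwo hp K hK2).kerSubgroup, (x : absoluteGaloisGroup K) • t = t) → t = 0 :=
    geomPrimaryTorsion_eq_zero_of_forall_kerSubgroup_smul W p hp hX hap K w hK2 hw (κ.restrictOfFinrankEqTwo hp K hK2)
  -- (I6) joint injectivity (g18 p769853)
  have hjoint : ∀ φ : contOneCocycles (discreteTopRep (κ.restrictOfFinrankEqTwo hp K hK2).kerSubgroup (GreenbergSelmer.Cofree θ (padicCoeffField S))),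
      (∀ x, φ.1 x ∈ Sπ) →
      (∀ (l : Fin d) (ψ' : contOneCocycles (discreteTopRep (κ.restrictOfFinrankEqTwo hp K hK2).kerSubgroup ((W.baseChange K).geomPrimaryTorsion p))),
        (∀ x, ψ'.1 x = s l (φ.1 x)) → oneCocycleClass _ ψ' = 0) → oneCocycleClass _ φ = 0 := fun φ hφ hzero ↦
    oneCocycleClass_eq_zero_of_forall_comp_eq_zero K W Φ k e₀ he₀ hk h2 hKU (κ.restrictOfFinrankEqTwo hp K hK2).kerSubgroup π Sπ hSπ hpS hT0
      s hs_S (fun m hm h0 ↦ hsinj m ((hSπ m).1 hm) h0) φ hφ hzero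
  -- the composition (LEAD g7 p770240)
  exact injTop_of_inputs K hK2 hp κ hκ v₀ hv₀ w ι ι₂ hcompat hι₂ hfixU W hirr ε 𝔪 hbad S₀ hS₀bad eN heN einf heinf einf' heinf' incN hincN hc hcU
    hN hNinf (fun n m ↦ continuous_subgroup_smul_geomPrimaryTorsion W p (κ.layerSubgroup n) m)
    (continuous_subgroup_smul_geomPrimaryTorsion W p κ.kerSubgroup) (continuous_subgroup_smul_geomTorsion W p κ.kerSubgroup) hopen j π Sπ hSπ
    (continuous_smul_cofree θ) (fun m ↦ exists_smul_eq_cofree θ hπ.ne_zero m) hπp ((W.baseChange K).continuous_smul_geomPrimaryTorsion p)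
    (inertiaIn_layerSubgroup_smul_cofree_eq W 𝔪 hbad S₀ hS₀bad θ (fun w' h1 h2 ↦ (hθ w' h1 h2).1) (κ.restrictOfFinrankEqTwo hp K hK2))
    d s hs_loc (fun l n v' hv' ↦ hs_gen (κ.restrictOfFinrankEqTwo hp K hK2) ε l n v' hv') hs_S (uK b) (hû_loc b)
    (fun n v' hv' ↦ hû_stab b (κ.restrictOfFinrankEqTwo hp K hK2) ε n v' hv') u v hu hv' hcu hvu hbridge hjoint hJ

end Summit.BirchSwinnertonDyer.BirchSwinnertonDyer.Theorems.SmallImageRttCharRoad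

end
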